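import Summits.KontsevichZagierPeriods.KontsevichZagierPeriods.Theorems.SoloInformedKZStokesCells
import Mathlib.MeasureTheory.Measure.Lebesgue.EqHaar
import HarnessLib

/-!
# SoloInformed — the standard simplex in every dimension; affine symmetries and sums as KZ moves

Support file for the general-dimension KZ–Stokes theorem (`SoloInformedKZStokesSimplex.lean`:
Stokes' formula on the standard `(m+1)`-simplex is a combination of the four Kontsevich–Zagier
moves of `KZCalculus.lean`). Contents:

* the closed standard simplex `soloInformedSimplex k = {t | 0 ≤ tᵢ, Σ tᵢ ≤ 1} ⊆ ℝᵏ`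
  (`ℚ`-semialgebraic, compact, of positive volume) and the representation constructor
  `soloInformedSimplexRep` (continuous semialgebraic integrands);
* **affine automorphisms of the simplex are change-of-variables moves**
  (`soloInformed_of_sub_of_affine_mem_relations`): if `Φ = c + L` maps `Δᵏ` bijectively onto
  itself then `|det L| = 1` — proved measure-theoretically, `vol(Φ(Δ)) = |det L| · vol(Δ)` with
  `0 < vol(Δ) < ∞` (`MeasureTheory.Measure.addHaar_image_continuousLinearMap`), so no determinant
  of a permutation or vertex-relabelling matrix is ever computed;
* **finite (signed) integrand additivity** (`soloInformed_of_sub_sum_mem_relations`,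
  `soloInformed_of_sub_signedSum_mem_relations`): `[σ, Σᵢ εᵢ fᵢ] − Σᵢ εᵢ [σ, fᵢ] ∈ KZ.relations`
  for signs `εᵢ = ±1`, by induction from the binary move (1b).

Residency `solo-KontsevichZagierPeriods-informed` (PLAN.md THEOREM D, dictionary §3: the engine of
the transfer from cohomological period relations to the naive calculus).
References: M. Kontsevich, D. Zagier, *Periods* (2001), §1.2; J. Bochnak, M. Coste, M.-F. Roy,
*Real Algebraic Geometry* (1998), §2.1–2.2.
-/

noncomputable section

open MeasureTheory Set Filter
open scoped Topology

namespace Summit.KontsevichZagierPeriods.KontsevichZagierPeriods.Theorems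

open Literature.NumberTheory.Transcendental Literature.NumberTheory.Transcendental.KZ
open Literature.ModelTheory.ExponentialFields (IsSemialgebraic isSemialgebraic_setOf_eval_le)

/-! ### The standard simplex -/

/-- The closed standard `k`-simplex `{t ∈ ℝᵏ | 0 ≤ tᵢ for all i, Σᵢ tᵢ ≤ 1}` (vertices the origin
and the standard basis vectors). -/
def soloInformedSimplex (k : ℕ) : Set (Fin k → ℝ) := {t | (∀ i, 0 ≤ t i) ∧ ∑ i, t i ≤ 1}

/-- Membership in the simplex. -/
theorem soloInformed_mem_simplex_iff {k : ℕ} {t : Fin k → ℝ} :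
    t ∈ soloInformedSimplex k ↔ (∀ i, 0 ≤ t i) ∧ ∑ i, t i ≤ 1 := Iff.rfl

/-- The simplex is `ℚ`-semialgebraic. [BCR 1998, §2.1] -/
theorem isSemialgebraic_soloInformedSimplex (k : ℕ) : IsSemialgebraic ℚ (soloInformedSimplex k) := by
  have h1 : IsSemialgebraic ℚ (⋂ i ∈ (Finset.univ : Finset (Fin k)), {t : Fin k → ℝ | 0 ≤ t i}) :=
    IsSemialgebraic.biInter Finset.univ _ fun i _ => by
      simpa using isSemialgebraic_setOf_eval_le (k := ℚ) (R := ℝ) (0 : MvPolynomial (Fin k) ℚ)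
        (MvPolynomial.X i)
  have h2 : IsSemialgebraic ℚ {t : Fin k → ℝ | ∑ i, t i ≤ 1} := by
    simpa using isSemialgebraic_setOf_eval_le (k := ℚ) (R := ℝ)
      (∑ i, MvPolynomial.X i : MvPolynomial (Fin k) ℚ) 1
  have hset : soloInformedSimplex k =
      (⋂ i ∈ (Finset.univ : Finset (Fin k)), {t : Fin k → ℝ | 0 ≤ t i}) ∩ {t | ∑ i, t i ≤ 1} := by
    ext t
    simp [soloInformedSimplex]
  rw [hset]
  exact h1.inter h2

/-- The simplex lies in the unit cube. -/
theorem soloInformedSimplex_subset_Icc (k : ℕ) : soloInformedSimplex k ⊆ Icc 0 1 := by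
  rintro t ⟨h0, h1⟩
  refine ⟨fun i => h0 i, fun i => ?_⟩
  exact (Finset.single_le_sum (fun j _ => h0 j) (Finset.mem_univ i)).trans h1

/-- The simplex is closed. -/
theorem isClosed_soloInformedSimplex (k : ℕ) : IsClosed (soloInformedSimplex k) := by
  have hset : soloInformedSimplex k = (⋂ i, {t : Fin k → ℝ | 0 ≤ t i}) ∩ {t | ∑ i, t i ≤ 1} := by
    ext t
    simp [soloInformedSimplex]
  rw [hset]
  exact (isClosed_iInter fun i => isClosed_le continuous_const (continuous_apply i)).inter
    (isClosed_le (continuous_finsetSum _ fun i _ => continuous_apply i) continuous_const)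

/-- The simplex is compact. -/
theorem isCompact_soloInformedSimplex (k : ℕ) : IsCompact (soloInformedSimplex k) :=
  isCompact_Icc.of_isClosed_subset (isClosed_soloInformedSimplex k) (soloInformedSimplex_subset_Icc k)

/-- The simplex has finite volume. -/
theorem volume_soloInformedSimplex_ne_top (k : ℕ) : volume (soloInformedSimplex k) ≠ ⊤ :=
  (isCompact_soloInformedSimplex k).measure_lt_top.ne

/-- The simplex has positive volume (it contains the cube `[0, 1/(k+1)]ᵏ`). -/
theorem volume_soloInformedSimplex_ne_zero (k : ℕ) : volume (soloInformedSimplex k) ≠ 0 := by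
  have hk : (0 : ℝ) < (k : ℝ) + 1 := by positivity
  have hsub : Icc (0 : Fin k → ℝ) (fun _ => 1 / ((k : ℝ) + 1)) ⊆ soloInformedSimplex k := by
    intro t ht
    rw [mem_Icc, Pi.le_def, Pi.le_def] at ht
    refine ⟨ht.1, ?_⟩
    calc ∑ i, t i ≤ ∑ _i : Fin k, 1 / ((k : ℝ) + 1) := Finset.sum_le_sum fun i _ => ht.2 i
      _ = (k : ℝ) / ((k : ℝ) + 1) := by
          rw [Finset.sum_const, Finset.card_univ, Fintype.card_fin, nsmul_eq_mul]; ring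
      _ ≤ 1 := (div_le_one hk).2 (by linarith)
  intro h0
  have h := measure_mono_null hsub h0
  rw [Real.volume_Icc_pi] at h
  simp only [Pi.zero_apply, sub_zero, Finset.prod_const, Finset.card_univ, Fintype.card_fin,
    pow_eq_zero_iff', ENNReal.ofReal_eq_zero, ne_eq] at h
  exact absurd h.1 (not_le.2 (by positivity))

/-! ### Representations over the simplex -/

/-- The representation `[Δᵏ, f]` for a `ℚ`-semialgebraic `f` continuous on the simplex. -/
def soloInformedSimplexRep (k : ℕ) (f : (Fin k → ℝ) → ℝ)
    (hs : IsSemialgebraicFunOn ℚ (soloInformedSimplex k) f)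
    (hc : ContinuousOn f (soloInformedSimplex k)) : IntegralRep k :=
  ⟨soloInformedSimplex k, f, isSemialgebraic_soloInformedSimplex k, hs,
    hc.integrableOn_compact (isCompact_soloInformedSimplex k)⟩

/-- Domain of `soloInformedSimplexRep`. -/
@[simp] theorem soloInformedSimplexRep_domain (k : ℕ) (f : (Fin k → ℝ) → ℝ)
    (hs : IsSemialgebraicFunOn ℚ (soloInformedSimplex k) f)
    (hc : ContinuousOn f (soloInformedSimplex k)) :
    (soloInformedSimplexRep k f hs hc).domain = soloInformedSimplex k := rfl

/-- Integrand of `soloInformedSimplexRep`. -/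
@[simp] theorem soloInformedSimplexRep_integrand (k : ℕ) (f : (Fin k → ℝ) → ℝ)
    (hs : IsSemialgebraicFunOn ℚ (soloInformedSimplex k) f)
    (hc : ContinuousOn f (soloInformedSimplex k)) :
    (soloInformedSimplexRep k f hs hc).integrand = f := rfl

/-! ### Affine automorphisms of the simplex are change-of-variables moves -/

/-- **Volume trick.** A continuous linear map `L` such that a translate of `L(Δᵏ)` is `Δᵏ` has
`|det L| = 1`: `vol(c + L(Δ)) = |det L| · vol(Δ)` and `0 < vol(Δ) < ∞`. -/
theorem soloInformed_abs_det_eq_one_of_image_simplex {k : ℕ} (L : (Fin k → ℝ) →L[ℝ] (Fin k → ℝ))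
    (c : Fin k → ℝ) {Φ : (Fin k → ℝ) → (Fin k → ℝ)} (hΦ : ∀ x, Φ x = c + L x)
    (himage : Φ '' soloInformedSimplex k = soloInformedSimplex k) : |L.det| = 1 := by
  have hΦ' : Φ = (fun y => c + y) ∘ L := funext fun x => by simp [hΦ x]
  have h1 : volume (Φ '' soloInformedSimplex k) =
      ENNReal.ofReal |L.det| * volume (soloInformedSimplex k) := by
    rw [hΦ', Set.image_comp, Set.image_add_left, measure_preimage_add,
      Measure.addHaar_image_continuousLinearMap]
  rw [himage] at h1
  have h2 : volume (soloInformedSimplex k) * ENNReal.ofReal |L.det| =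
      volume (soloInformedSimplex k) * 1 := by
    rw [mul_one, mul_comm]
    exact h1.symm
  rw [ENNReal.mul_right_inj (volume_soloInformedSimplex_ne_zero k)
    (volume_soloInformedSimplex_ne_top k), ENNReal.ofReal_eq_one] at h2
  exact h2

/-- **Affine automorphisms of the simplex are change-of-variables moves.** If `Φ = c + L` is a
`ℚ`-semialgebraic map carrying `Δᵏ` injectively onto itself, and the integrands satisfy
`f = f' ∘ Φ` on `Δᵏ`, then `[Δᵏ, f] − [Δᵏ, f'] ∈ KZ.relations` (rule (2) with Jacobian `|det L| = 1`
by `soloInformed_abs_det_eq_one_of_image_simplex`). [Kontsevich–Zagier 2001, §1.2 rule (2)] -/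
theorem soloInformed_of_sub_of_affine_mem_relations {k : ℕ} (L : (Fin k → ℝ) →L[ℝ] (Fin k → ℝ))
    (c : Fin k → ℝ) {Φ : (Fin k → ℝ) → (Fin k → ℝ)} (hΦ : ∀ x, Φ x = c + L x)
    (hsa : IsSemialgebraicMapOn ℚ (soloInformedSimplex k) Φ)
    (hinj : InjOn Φ (soloInformedSimplex k))
    (himage : Φ '' soloInformedSimplex k = soloInformedSimplex k) (r r' : IntegralRep k)
    (hr : r.domain = soloInformedSimplex k) (hr' : r'.domain = soloInformedSimplex k)
    (h : ∀ x ∈ soloInformedSimplex k, r.integrand x = r'.integrand (Φ x)) :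
    of r - of r' ∈ relations := by
  have hdet : |L.det| = 1 := soloInformed_abs_det_eq_one_of_image_simplex L c hΦ himage
  have hΦ' : Φ = fun x => c + L x := funext hΦ
  have hderiv : ∀ x ∈ r.domain, HasFDerivWithinAt Φ (L : (Fin k → ℝ) →L[ℝ] (Fin k → ℝ)) r.domain x :=
    fun x _ => by
      rw [hΦ']
      exact (L.hasFDerivAt.const_add c).hasFDerivWithinAt
  refine changeOfVariablesRel_subset_relations ⟨k, r, r', Φ, fun _ => L, by rw [hr]; exact hsa,
    hderiv, by rw [hr]; exact hinj, by rw [hr', hr, himage], fun x hx => ?_, rfl⟩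
  show r.integrand x = r'.integrand (Φ x) * |L.det|
  rw [hdet, mul_one]
  exact h x (hr ▸ hx)

/-! ### Finite integrand additivity -/

/-- Finite sums of `ℚ`-semialgebraic functions are `ℚ`-semialgebraic. [BCR 1998, Prop. 2.2.6] -/
theorem soloInformed_isSemialgebraicFunOn_sum {n N : ℕ} {s : Set (Fin n → ℝ)}
    (hs : IsSemialgebraic ℚ s) (f : Fin N → (Fin n → ℝ) → ℝ)
    (hf : ∀ i, IsSemialgebraicFunOn ℚ s (f i)) :
    IsSemialgebraicFunOn ℚ s (fun x => ∑ i, f i x) := by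
  induction N with
  | zero => simpa using isSemialgebraicFunOn_ratCast hs 0
  | succ N ih =>
    have h := IsSemialgebraicFunOn.add_holds (hf 0) (ih (fun i => f i.succ) fun i => hf i.succ)
    refine h.congr fun x _ => ?_
    simp [Fin.sum_univ_succ]

/-- **Finite integrand additivity.** If `r` and all `rs i` have the same domain and
`r.integrand = Σᵢ (rs i).integrand` on it, then `[r] − Σᵢ [rs i] ∈ KZ.relations`.
[Kontsevich–Zagier 2001, §1.2 rule (1)] -/
theorem soloInformed_of_sub_sum_mem_relations {n : ℕ} :
    ∀ {N : ℕ} (r : IntegralRep n) (rs : Fin N → IntegralRep n),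
      (∀ i, (rs i).domain = r.domain) →
      EqOn r.integrand (fun x => ∑ i, (rs i).integrand x) r.domain →
      of r - ∑ i, of (rs i) ∈ relations
  | 0, r, rs, _, h => by
    simp only [Finset.univ_eq_empty, Finset.sum_empty, sub_zero]
    exact of_mem_relations_of_eqOn_zero r fun x hx => by simpa using h hx
  | N + 1, r, rs, hd, h => by
    -- the partial sum over `i ≥ 1` as a representation
    have hS : IsSemialgebraicFunOn ℚ r.domain (fun x => ∑ i : Fin N, (rs i.succ).integrand x) :=
      soloInformed_isSemialgebraicFunOn_sum r.isSemialgebraic_domain _ fun i =>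
        hd i.succ ▸ (rs i.succ).isSemialgebraicFunOn_integrand
    have hI : IntegrableOn (fun x => ∑ i : Fin N, (rs i.succ).integrand x) r.domain :=
      integrable_finsetSum _ fun i _ => hd i.succ ▸ (rs i.succ).integrableOn
    let r₁ : IntegralRep n := ⟨r.domain, _, r.isSemialgebraic_domain, hS, hI⟩
    have h1 : of r - of (rs 0) - of r₁ ∈ relations :=
      integrandAddRel_subset_relations ⟨n, r, rs 0, r₁, hd 0, rfl, fun x hx => by
        rw [h hx]
        simp [Fin.sum_univ_succ, r₁], rfl⟩
    have h2 : of r₁ - ∑ i : Fin N, of (rs i.succ) ∈ relations :=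
      soloInformed_of_sub_sum_mem_relations r₁ (fun i => rs i.succ) (fun i => hd i.succ)
        fun x _ => rfl
    have key : of r - ∑ i, of (rs i) = (of r - of (rs 0) - of r₁) +
        (of r₁ - ∑ i : Fin N, of (rs i.succ)) := by
      rw [Fin.sum_univ_succ]
      abel
    rw [key]
    exact relations.add_mem h1 h2

/-- **Finite signed integrand additivity.** For signs `εᵢ ∈ {1, −1}`: if `r` and all `rs i` have the
same domain and `r.integrand = Σᵢ εᵢ (rs i).integrand` on it, then `[r] − Σᵢ εᵢ [rs i] ∈
KZ.relations` (negative signs through `[σ, −f] + [σ, f] ∈ relations`).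
[Kontsevich–Zagier 2001, §1.2 rule (1)] -/
theorem soloInformed_of_sub_signedSum_mem_relations {n N : ℕ} (r : IntegralRep n)
    (rs : Fin N → IntegralRep n) (ε : Fin N → ℤ) (hε : ∀ i, ε i = 1 ∨ ε i = -1)
    (hd : ∀ i, (rs i).domain = r.domain)
    (h : EqOn r.integrand (fun x => ∑ i, (ε i : ℝ) * (rs i).integrand x) r.domain) :
    of r - ∑ i, ε i • of (rs i) ∈ relations := by
  classical
  let rs' : Fin N → IntegralRep n := fun i => if ε i = 1 then rs i else (rs i).neg
  have hd' : ∀ i, (rs' i).domain = r.domain := fun i => by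
    by_cases hi : ε i = 1 <;> simp [rs', hi, hd i]
  have hi' : ∀ i x, (rs' i).integrand x = (ε i : ℝ) * (rs i).integrand x := fun i x => by
    rcases hε i with hi | hi
    · simp [rs', hi]
    · simp [rs', hi]
  have h1 : of r - ∑ i, of (rs' i) ∈ relations :=
    soloInformed_of_sub_sum_mem_relations r rs' hd' fun x hx => by
      rw [h hx]
      exact Finset.sum_congr rfl fun i _ => (hi' i x).symm
  have h2 : ∀ i, of (rs' i) - ε i • of (rs i) ∈ relations := fun i => by
    rcases hε i with hi | hi
    · simp [rs', hi, relations.zero_mem]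
    · simp only [rs', hi, neg_smul, one_smul, sub_neg_eq_add, Int.reduceNeg]
      rw [add_comm]
      exact of_add_of_mem_relations_of_eqOn_neg (r := rs i) (r' := (rs i).neg) rfl fun x _ => rfl
  have key : of r - ∑ i, ε i • of (rs i) =
      (of r - ∑ i, of (rs' i)) + ∑ i, (of (rs' i) - ε i • of (rs i)) := by
    rw [Finset.sum_sub_distrib]
    abel
  rw [key]
  exact relations.add_mem h1 (sum_mem fun i _ => h2 i)

end Summit.KontsevichZagierPeriods.KontsevichZagierPeriods.Theorems
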